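/-
Copyright (c) 2026 the pub-hodgecm-mathlib formalisation cell (harness21).  Prover seat hodgecm-mathlib-F0P3a-p06-g25 (PLACE-FREE LAYER after RIDER 2b; `hd ↦ hϖ` substitution
certified by «LH5» LH5-p04 (g10) 01:14:50Z∕01:18:12Z; LEAD F0P3a-plan (g16) T15-25 (a)(c), T15-30 (i); G-row LEDGER v13 OPEN item); 2026-09-03.
-/
import Summits.HodgeConjecture.HodgeConjecture.Theorems.F0P3cStCharTSStIwahoriHeads     -- ★ E p853236 (this seat): `comp_iota_eq_one_iff`; brings ★ A, ★ C, ★ D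
import Summits.HodgeConjecture.HodgeConjecture.Theorems.F0P3cStCharTSStIwahoriFixedPF   -- P2a (this seat): the place-free `I`∕`K₁` counts; brings P1
import HarnessLib

/-!
# F0 · P3c · line LH6 «StCharTS» — PLACE-FREE LAYER P2b «IWAHORI-HEADS-PF»: `dim St_G(ψ)^{I} = [ψ = 1]`, `St_G(ψ)^{K₁} = 0` over the uniformiser token `hϖ` alone
# (EVERY non-split `v`, unramified or tamely ramified)

Cell `pub/hodgecm-mathlib` (D-0151), FLOOR 0, crux item H413 = `stmt-HodgeConjecture-24833` (`--supports` lane, helper; seat F0P3a-p06 (g25)).  THEOREMS ONLY.  The three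
heads of ★ E `F0P3cStCharTSStIwahoriHeads` with `hd ↦ hϖ : Valued.v ϖ = WithZero.exp (-1 : ℤ)` («LH5» LH5-p04 (g10)'s certified substitution), proofs unchanged but reading
P2a ∕ P1 for the datum-dependent inputs: **`finrank_fixedPoints_st_I`**, `finrank_fixedPoints_st_K1_eq_zero`, **`st_fixedPoints_K1_eq_bot`**.
HONEST LABEL: count-neutral helper (place-free twin for the NOT-WILD EP-PAIRS head P4); the ★ file is NOT edited; closes no node; HC_CM is proved only modulo the 7 printed
citations (hLiu418 = stmt-HodgeConjecture-24832, h413 = stmt-HodgeConjecture-24833) until rung 0 closes.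

## References
* [Rogawski1990] J. D. Rogawski, *Automorphic Representations of Unitary Groups in Three Variables*, Ann. of Math. Stud. 123 (1990), §12.2 (1) pp. 172–173, §12.6 p. 188.
* [Borel1976] A. Borel, *Admissible representations … fixed under an Iwahori subgroup*, Invent. Math. 35 (1976), §3–§4.
* [Casselman1995] W. Casselman, *Introduction to the theory of admissible representations of 𝔭-adic reductive groups* (1995), §3.
-/

set_option autoImplicit false
-- the mandated namespace has the single-problem summit's repeated segment (`HodgeConjecture.HodgeConjecture`)
set_option linter.dupNamespace false

noncomputable section

open NumberField IsDedekindDomain MeasureTheory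
open scoped Matrix MatrixGroups NNReal WithZero
open Literature.NumberTheory.Automorphic Literature.NumberTheory.Automorphic.UnitaryGroup
open Literature.NumberTheory.Rogawski1990 Literature.NumberTheory.GaloisRepresentations

namespace Summit.HodgeConjecture.HodgeConjecture.Cruxes.H413.F0P3cStCharTSStIwahoriHeadsPF

open Summit.HodgeConjecture.HodgeConjecture.Cruxes.H413
open Summit.HodgeConjecture.HodgeConjecture.Cruxes.H413.F0P3cStCharTSStParahoricFixed
open Summit.HodgeConjecture.HodgeConjecture.Cruxes.H413.F0P3XiPacketFamilyOfRecord (isAdmissible_of_isConstituentOf)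

variable (L : Type) [Field L] [NumberField L] [IsCMField L] (v : HeightOneSpectrum (𝓞 ↥(maximalRealSubfield L)))
  (w : PlacesOver L v) (hw : IsCMField.complexConj L • w.1 = w.1)
  (eA : Gqs L v ≃ₜ* ↥(unitaryGroupOfForm (galAdicCompletionMap (L := L) (IsCMField.complexConj L) hw) ((StdForm.antidiagonal 3).over (w.1.adicCompletion L))))
  (heA : ∀ g : Gqs L v,
    ((eA g : ↥(unitaryGroupOfForm (galAdicCompletionMap (L := L) (IsCMField.complexConj L) hw) ((StdForm.antidiagonal 3).over (w.1.adicCompletion L)))) :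
        GL (Fin 3) (w.1.adicCompletion L)) =
      ((localNonsplitEquiv (IsCMField.complexConj L) (qsForm L) (IsCMField.complexConj_ne_one L) w hw g :
        ↥(unitaryGroupOfForm (galAdicCompletionMap (L := L) (IsCMField.complexConj L) hw) (placeForm (qsForm L) w.1))) : GL (Fin 3) (w.1.adicCompletion L)))

include heA in
open Classical in
set_option maxHeartbeats 1600000 in
set_option synthInstance.maxHeartbeats 400000 in
-- instance-path unification between `Gqs L v` and the literal carrier of ★ `cmPrincipalSeries`
/-- **`dim St_G(ψ)^{I} = [ψ = 1]`**: every representative of `St_G(ψ)` (every continuous `ψ`) has a LINE of Iwahori-fixed vectors if `ψ = 1` and none otherwise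
(H1 at `I` + FILE D's `2·[ψ∘ι = 1]` − H2's `[ψ = 1]`, `I ∋ d(1,b,1)` by FILE C). [cite: Rogawski1990, §12.2 (1) p. 173; §12.6 p. 188] [cite: Borel1976, §3–§4] -/
theorem finrank_fixedPoints_st_I (hns : ∀ w' : PlacesOver L v, IsCMField.complexConj L • w'.1 = w'.1) {ϖ : w.1.adicCompletion L} (hϖ : Valued.v ϖ = WithZero.exp (-1 : ℤ))
    (g₁ : GL (Fin 3) (w.1.adicCompletion L)) (hg₁ : (g₁ : Matrix (Fin 3) (Fin 3) (w.1.adicCompletion L)) = Matrix.diagonal ![(1 : w.1.adicCompletion L), 1, ϖ])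
    (K0 K1 I : Subgroup (Gqs L v))
    (hK0 : K0 = ((glInt 3 (w.1.adicCompletion L)).subgroupOf
      (unitaryGroupOfForm (galAdicCompletionMap (L := L) (IsCMField.complexConj L) hw) ((StdForm.antidiagonal 3).over (w.1.adicCompletion L)))).comap
        eA.toMulEquiv.toMonoidHom)
    (hK1 : K1 = (((glInt 3 (w.1.adicCompletion L)).map (MulAut.conj g₁).toMonoidHom).subgroupOf
      (unitaryGroupOfForm (galAdicCompletionMap (L := L) (IsCMField.complexConj L) hw) ((StdForm.antidiagonal 3).over (w.1.adicCompletion L)))).comap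
        eA.toMulEquiv.toMonoidHom)
    (hI : I = K0 ⊓ K1)
    (ι : ↥(normOneUnits (conjLocal L (IsCMField.complexConj L) v)) →* ↥(Subgroup.center (Gqs L v))) (hιc : Continuous ι)
    (hι : ∀ z : ↥(normOneUnits (conjLocal L (IsCMField.complexConj L) v)),
      ((ι z).val.val.val : Matrix (Fin 3) (Fin 3) (LocalRing L v)) = (((z : (LocalRing L v)ˣ) : LocalRing L v)) • (1 : Matrix (Fin 3) (Fin 3) (LocalRing L v)))
    (detZ : Gqs L v →* ↥(Subgroup.center (Gqs L v)))
    (hdetZ : ∀ g : Gqs L v, ((detZ g).val.val.val : Matrix (Fin 3) (Fin 3) (LocalRing L v)) =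
        (g.val.val : Matrix (Fin 3) (Fin 3) (LocalRing L v)).det • (1 : Matrix (Fin 3) (Fin 3) (LocalRing L v)))
    (stG detG : (↥(Subgroup.center (Gqs L v)) →* ℂˣ) → IrrClass (Gqs L v))
    (ψ : ↥(Subgroup.center (Gqs L v)) →* ℂˣ) (hψ : Continuous ψ)
    (hopen : IsOpen (((ψ.comp detZ).ker : Subgroup (Gqs L v)) : Set (Gqs L v)))
    (hdet : detG ψ = IrrClass.mk (SmoothIrrep.ofChar (ψ.comp detZ) hopen))
    (hne : stG ψ ≠ detG ψ)
    (hJH : ∀ c : IrrClass (Gqs L v),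
      c.IsConstituentOf (cmPrincipalSeries L 3 v
        (cmTorusCharPair L v (halfModulusChar (LocalRing L v) * halfModulusChar (LocalRing L v))⁻¹ (ψ.comp ι))) ↔ (c = stG ψ ∨ c = detG ψ))
    (r : SmoothIrrep (Gqs L v)) (hr : IrrClass.mk r = stG ψ) :
    Module.finrank ℂ (r.ρ.fixedPoints I) = if ψ = 1 then 1 else 0 := by
  have hlev := F0P3cStCharTSStLevelsTransport.isOpen_isCompact_levels L v w hw eA g₁ K0 K1 I hK0 hK1 hI
  have hψι : Continuous fun x => (((ψ.comp ι) x : ℂˣ) : ℂ) := Units.continuous_val.comp (hψ.comp hιc)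
  have h1 := finrank_fixedPoints_st_eq_sub L v hns (ψ.comp ι) hψι hne hJH (ψ.comp detZ) hopen hdet r hr I hlev.2.2.1 hlev.2.2.2
  have h3 := F0P3cStCharTSStIwahoriFixedPF.finrank_fixedPoints_cmPrincipalSeries_stChar_I L v w hw eA heA hns hϖ g₁ hg₁ K0 K1 I hK0 hK1 hI (ψ.comp ι)
  have h2 := comp_detZ_eq_one_on_iff L v hns ι hι detZ hdetZ I
    (fun b g hg => F0P3cStCharTSStLevelsPF.mem_I_of_coe_eq_diagonal L v w hw eA heA hns hϖ g₁ hg₁ K0 K1 I hK0 hK1 hI b g hg) ψ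
  have hιψ := F0P3cStCharTSStIwahoriHeads.comp_iota_eq_one_iff L v hns ι hι ψ
  have h2' : (∀ k ∈ I, (ψ.comp detZ) k = 1) ↔ ψ = 1 := by
    simp only [MonoidHom.comp_apply]
    exact h2
  rw [h1, h3]
  by_cases hψ1 : ψ = 1
  · rw [if_pos (hιψ.2 hψ1), if_pos (h2'.2 hψ1), if_pos hψ1]
  · rw [if_neg (fun h => hψ1 (hιψ.1 h)), if_neg (fun h => hψ1 (h2'.1 h)), if_neg hψ1]

include heA in
open Classical in
set_option maxHeartbeats 1600000 in
set_option synthInstance.maxHeartbeats 400000 in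
-- instance-path unification between `Gqs L v` and the literal carrier of ★ `cmPrincipalSeries`
/-- **`dim St_G(ψ)^{K₁} = 0`** (H1 at `K₁` + FILE D's `[ψ∘ι = 1]` − H2's `[ψ = 1]`, `K₁ ≥ I ∋ d(1,b,1)`). [cite: Rogawski1990, §12.2 (1) p. 173; §12.6 p. 188] [cite: Borel1976, §3–§4] -/
theorem finrank_fixedPoints_st_K1_eq_zero (hns : ∀ w' : PlacesOver L v, IsCMField.complexConj L • w'.1 = w'.1) {ϖ : w.1.adicCompletion L} (hϖ : Valued.v ϖ = WithZero.exp (-1 : ℤ))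
    (g₁ : GL (Fin 3) (w.1.adicCompletion L)) (hg₁ : (g₁ : Matrix (Fin 3) (Fin 3) (w.1.adicCompletion L)) = Matrix.diagonal ![(1 : w.1.adicCompletion L), 1, ϖ])
    (K0 K1 I : Subgroup (Gqs L v))
    (hK0 : K0 = ((glInt 3 (w.1.adicCompletion L)).subgroupOf
      (unitaryGroupOfForm (galAdicCompletionMap (L := L) (IsCMField.complexConj L) hw) ((StdForm.antidiagonal 3).over (w.1.adicCompletion L)))).comap
        eA.toMulEquiv.toMonoidHom)
    (hK1 : K1 = (((glInt 3 (w.1.adicCompletion L)).map (MulAut.conj g₁).toMonoidHom).subgroupOf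
      (unitaryGroupOfForm (galAdicCompletionMap (L := L) (IsCMField.complexConj L) hw) ((StdForm.antidiagonal 3).over (w.1.adicCompletion L)))).comap
        eA.toMulEquiv.toMonoidHom)
    (hI : I = K0 ⊓ K1)
    (ι : ↥(normOneUnits (conjLocal L (IsCMField.complexConj L) v)) →* ↥(Subgroup.center (Gqs L v))) (hιc : Continuous ι)
    (hι : ∀ z : ↥(normOneUnits (conjLocal L (IsCMField.complexConj L) v)),
      ((ι z).val.val.val : Matrix (Fin 3) (Fin 3) (LocalRing L v)) = (((z : (LocalRing L v)ˣ) : LocalRing L v)) • (1 : Matrix (Fin 3) (Fin 3) (LocalRing L v)))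
    (detZ : Gqs L v →* ↥(Subgroup.center (Gqs L v)))
    (hdetZ : ∀ g : Gqs L v, ((detZ g).val.val.val : Matrix (Fin 3) (Fin 3) (LocalRing L v)) =
        (g.val.val : Matrix (Fin 3) (Fin 3) (LocalRing L v)).det • (1 : Matrix (Fin 3) (Fin 3) (LocalRing L v)))
    (stG detG : (↥(Subgroup.center (Gqs L v)) →* ℂˣ) → IrrClass (Gqs L v))
    (ψ : ↥(Subgroup.center (Gqs L v)) →* ℂˣ) (hψ : Continuous ψ)
    (hopen : IsOpen (((ψ.comp detZ).ker : Subgroup (Gqs L v)) : Set (Gqs L v)))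
    (hdet : detG ψ = IrrClass.mk (SmoothIrrep.ofChar (ψ.comp detZ) hopen))
    (hne : stG ψ ≠ detG ψ)
    (hJH : ∀ c : IrrClass (Gqs L v),
      c.IsConstituentOf (cmPrincipalSeries L 3 v
        (cmTorusCharPair L v (halfModulusChar (LocalRing L v) * halfModulusChar (LocalRing L v))⁻¹ (ψ.comp ι))) ↔ (c = stG ψ ∨ c = detG ψ))
    (r : SmoothIrrep (Gqs L v)) (hr : IrrClass.mk r = stG ψ) :
    Module.finrank ℂ (r.ρ.fixedPoints K1) = 0 := by
  have hlev := F0P3cStCharTSStLevelsTransport.isOpen_isCompact_levels L v w hw eA g₁ K0 K1 I hK0 hK1 hI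
  have hψι : Continuous fun x => (((ψ.comp ι) x : ℂˣ) : ℂ) := Units.continuous_val.comp (hψ.comp hιc)
  have h1 := finrank_fixedPoints_st_eq_sub L v hns (ψ.comp ι) hψι hne hJH (ψ.comp detZ) hopen hdet r hr K1 hlev.2.1.1 hlev.2.1.2
  have h3 := F0P3cStCharTSStIwahoriFixedPF.finrank_fixedPoints_cmPrincipalSeries_stChar_K1 L v w hw eA heA hns hϖ g₁ hg₁ K0 K1 I hK0 hK1 hI (ψ.comp ι)
  have h2 := comp_detZ_eq_one_on_iff L v hns ι hι detZ hdetZ K1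
    (fun b g hg => F0P3cStCharTSStLevelsTransport.I_le_K1 L v K0 K1 I hI (F0P3cStCharTSStLevelsPF.mem_I_of_coe_eq_diagonal L v w hw eA heA hns hϖ g₁ hg₁ K0 K1 I hK0 hK1 hI b g hg)) ψ
  have hιψ := F0P3cStCharTSStIwahoriHeads.comp_iota_eq_one_iff L v hns ι hι ψ
  have h2' : (∀ k ∈ K1, (ψ.comp detZ) k = 1) ↔ ψ = 1 := by
    simp only [MonoidHom.comp_apply]
    exact h2
  rw [h1, h3]
  by_cases hψ1 : ψ = 1
  · rw [if_pos (hιψ.2 hψ1), if_pos (h2'.2 hψ1)]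
  · rw [if_neg (fun h => hψ1 (hιψ.1 h)), if_neg (fun h => hψ1 (h2'.1 h))]

include heA in
set_option maxHeartbeats 1600000 in
set_option synthInstance.maxHeartbeats 400000 in
-- instance-path unification between `Gqs L v` and the literal carrier of ★ `cmPrincipalSeries`
/-- **`St_G(ψ)` HAS NO `K₁`-FIXED VECTOR** (rank `0` + admissibility of the constituent `St_G(ψ)`, ★ `isAdmissible_of_isConstituentOf`): the type-two vertex term of
`Tr St_G(ψ)(f_EP^G)` vanishes. [cite: Rogawski1990, §12.2 (1) p. 173; §12.6 p. 188] [cite: Borel1976, §3–§4] [cite: Casselman1995, §3] -/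
theorem st_fixedPoints_K1_eq_bot (hns : ∀ w' : PlacesOver L v, IsCMField.complexConj L • w'.1 = w'.1) {ϖ : w.1.adicCompletion L} (hϖ : Valued.v ϖ = WithZero.exp (-1 : ℤ))
    (g₁ : GL (Fin 3) (w.1.adicCompletion L)) (hg₁ : (g₁ : Matrix (Fin 3) (Fin 3) (w.1.adicCompletion L)) = Matrix.diagonal ![(1 : w.1.adicCompletion L), 1, ϖ])
    (K0 K1 I : Subgroup (Gqs L v))
    (hK0 : K0 = ((glInt 3 (w.1.adicCompletion L)).subgroupOf
      (unitaryGroupOfForm (galAdicCompletionMap (L := L) (IsCMField.complexConj L) hw) ((StdForm.antidiagonal 3).over (w.1.adicCompletion L)))).comap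
        eA.toMulEquiv.toMonoidHom)
    (hK1 : K1 = (((glInt 3 (w.1.adicCompletion L)).map (MulAut.conj g₁).toMonoidHom).subgroupOf
      (unitaryGroupOfForm (galAdicCompletionMap (L := L) (IsCMField.complexConj L) hw) ((StdForm.antidiagonal 3).over (w.1.adicCompletion L)))).comap
        eA.toMulEquiv.toMonoidHom)
    (hI : I = K0 ⊓ K1)
    (ι : ↥(normOneUnits (conjLocal L (IsCMField.complexConj L) v)) →* ↥(Subgroup.center (Gqs L v))) (hιc : Continuous ι)
    (hι : ∀ z : ↥(normOneUnits (conjLocal L (IsCMField.complexConj L) v)),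
      ((ι z).val.val.val : Matrix (Fin 3) (Fin 3) (LocalRing L v)) = (((z : (LocalRing L v)ˣ) : LocalRing L v)) • (1 : Matrix (Fin 3) (Fin 3) (LocalRing L v)))
    (detZ : Gqs L v →* ↥(Subgroup.center (Gqs L v)))
    (hdetZ : ∀ g : Gqs L v, ((detZ g).val.val.val : Matrix (Fin 3) (Fin 3) (LocalRing L v)) =
        (g.val.val : Matrix (Fin 3) (Fin 3) (LocalRing L v)).det • (1 : Matrix (Fin 3) (Fin 3) (LocalRing L v)))
    (stG detG : (↥(Subgroup.center (Gqs L v)) →* ℂˣ) → IrrClass (Gqs L v))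
    (ψ : ↥(Subgroup.center (Gqs L v)) →* ℂˣ) (hψ : Continuous ψ)
    (hopen : IsOpen (((ψ.comp detZ).ker : Subgroup (Gqs L v)) : Set (Gqs L v)))
    (hdet : detG ψ = IrrClass.mk (SmoothIrrep.ofChar (ψ.comp detZ) hopen))
    (hne : stG ψ ≠ detG ψ)
    (hJH : ∀ c : IrrClass (Gqs L v),
      c.IsConstituentOf (cmPrincipalSeries L 3 v
        (cmTorusCharPair L v (halfModulusChar (LocalRing L v) * halfModulusChar (LocalRing L v))⁻¹ (ψ.comp ι))) ↔ (c = stG ψ ∨ c = detG ψ))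
    (r : SmoothIrrep (Gqs L v)) (hr : IrrClass.mk r = stG ψ) :
    r.ρ.fixedPoints K1 = ⊥ := by
  have hlev := F0P3cStCharTSStLevelsTransport.isOpen_isCompact_levels L v w hw eA g₁ K0 K1 I hK0 hK1 hI
  have h0 := finrank_fixedPoints_st_K1_eq_zero L v w hw eA heA hns hϖ g₁ hg₁ K0 K1 I hK0 hK1 hI ι hιc hι detZ hdetZ stG detG ψ hψ hopen hdet hne hJH r hr
  have hadmPS := F0P3XiUnramNonsplitInstance.isAdmissible_cmPrincipalSeries L v
    (cmTorusCharPair L v (halfModulusChar (LocalRing L v) * halfModulusChar (LocalRing L v))⁻¹ (ψ.comp ι))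
  have hadm : (stG ψ).IsAdmissible := isAdmissible_of_isConstituentOf ((hJH (stG ψ)).2 (Or.inl rfl)) hadmPS
  rw [← hr, IrrClass.isAdmissible_mk] at hadm
  haveI : Module.Finite ℂ (r.ρ.fixedPoints K1) := hadm.2 ⟨_, hlev.2.1.1⟩ hlev.2.1.2
  exact Submodule.finrank_eq_zero.1 h0

end Summit.HodgeConjecture.HodgeConjecture.Cruxes.H413.F0P3cStCharTSStIwahoriHeadsPF

end
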